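import Literature.NumberTheory.LFunctions.FordLargeLambdaCore
import Literature.Analysis.ValidatedNumerics.MultiPrecisionInterval
import HarnessLib

/-!
# The certificate checker for Ford's Theorem 2 on `λ`-intervals (kernel interval arithmetic)

Topic `Literature/NumberTheory/LFunctions`. Everything here is PROVED; no named fact is introduced
(the `def`s are the checker: an expression language, its interval evaluator, the parameter rows and
their Boolean check).

`FordVK.sec5_interval` (`FordLargeLambdaCore.lean`) proves Theorem 2 of K. Ford, Proc. LMS 85
(2002), on one `λ`-interval `[λ_lo, λ_hi]` (`λ_lo ≥ 87`, nontrivial range `log N ≥ 300λ²`) from a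
row of (1.7) (Theorem 3), Theorem 4, and a list `c0`–`c9` of side conditions on the chosen integer
parameters `(k, h, g, s, m₁, m₂, w⁺)` and `η`: rational inequalities, the condition (1.10) of
Theorem 4, the constant condition (5.30)-type `… ≤ log(9.463 − 0.002)` and the exponent condition
(5.31)-type at both endpoints. This file mechanises their verification for rows with rational data
(the analogue of Ford's "Program 2" behind Lemma 5.3, here for the whole range `87 ≤ λ ≤ 2025`):

* `FordVK.RExpr` — expressions in rational constants, `log n`, `log(1 − 1/n)`, `exp`, `+ − × ÷`;
  `RExpr.val` (real value), `RExpr.encl` (outward-rounded evaluation in the tree's fixed-point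
  interval engine `Literature.Analysis.ValidatedNumerics.NumericsMP.MI` at scale `2⁶⁴`, `48` series
  terms), `RExpr.mem_encl` (**soundness**), and the comparison lemmas `val_le_of_hi`,
  `le_val_of_lo`, `val_le_val`, `val_lt_of_hi`;
* `FordVK.Sec5Row` — a parameter row (`λ_lo = lamloN/lamD`, `λ_hi = lamhiN/lamD`, `k, h, g, s, m₁,
  m₂, w⁺`, `η = etaN/etaD`); `rhoN`, `thetaN` (the row of (1.7) by `k`), `rf = ⌊ρk²⌋`, `r`, `tau`;
  the expressions `e4` ((1.10)), `eCT4` (the constant of Theorem 4, (5.18)), `e8`, `eCt`, `eE2`,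
  `eZ0`, `Z1`, `e9`; `Sec5Row.check` (all of `c0`–`c9`); the value lemmas `val_e4`, …, `val_e9`;
* `FordVK.Sec5Row.sound` — **a checked row gives Theorem 2 with constant `9.463` on its interval**
  (nontrivial range), from the three rows of (1.7) (`hT3a–c`) and Theorem 4 (`hT4`).

The rows themselves and their kernel evaluation are in `FordLargeLambdaRows*.lean`; the assembly in
`FordLargeLambda.lean`.

## References
* K. Ford, Proc. London Math. Soc. (3) 85 (2002), 565–633; arXiv:1910.08209: §5, (1.7), (1.10),
  (5.13)–(5.31), Lemmas 5.2–5.3 and Program 2. [Ford2002]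
* R. E. Moore, *Interval Analysis* (1966) (inclusion property), via
  `Literature/Analysis/ValidatedNumerics/MultiPrecisionInterval.lean`. [folklore]
-/

open Finset Real

namespace Literature.NumberTheory.LFunctions
namespace FordVK

open Literature.Analysis.ValidatedNumerics Literature.Analysis.ValidatedNumerics.NumericsMP

/-! ### A small expression language with a certified interval evaluator -/

/-- Real expressions in rational data, `log` of naturals, `log(1 − 1/n)` and `exp`. [folklore] -/
inductive RExpr where
  | frac (p : ℤ) (q : ℕ) : RExpr
  | logNat (n : ℕ) : RExpr
  | logOneSubInv (n : ℕ) : RExpr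
  | add (a b : RExpr) : RExpr
  | sub (a b : RExpr) : RExpr
  | mul (a b : RExpr) : RExpr
  | div (a b : RExpr) : RExpr
  | neg (a : RExpr) : RExpr
  | exp (a : RExpr) : RExpr
  deriving Repr

namespace RExpr

/-- The real value of an expression (`frac p 0`, `logOneSubInv 0` have junk values). [folklore] -/
noncomputable def val : RExpr → ℝ
  | frac p q => (p : ℝ) / q
  | logNat n => Real.log n
  | logOneSubInv n => Real.log (1 - 1 / (n : ℝ))
  | add a b => val a + val b
  | sub a b => val a - val b
  | mul a b => val a * val b
  | div a b => val a / val b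
  | neg a => -val a
  | exp a => Real.exp (val a)

/-- The interval evaluator at scale `S` with `K` series terms and exponential range reduction `kr`.
[folklore] -/
def encl (S K kr : ℕ) : RExpr → Option MI
  | frac p q => if q = 0 then none else some (MI.ofFrac S p q)
  | logNat n => MI.logNat S K n
  | logOneSubInv n => if n = 0 then none else MI.logOneSub S K (MI.ofFrac S 1 n)
  | add a b =>
    match encl S K kr a, encl S K kr b with
    | some A, some B => some (A.add B)
    | _, _ => none
  | sub a b =>
    match encl S K kr a, encl S K kr b with
    | some A, some B => some (A.sub B)
    | _, _ => none
  | mul a b =>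
    match encl S K kr a, encl S K kr b with
    | some A, some B => some (MI.mul S A B)
    | _, _ => none
  | div a b =>
    match encl S K kr a, encl S K kr b with
    | some A, some B => MI.divPos S A B
    | _, _ => none
  | neg a =>
    match encl S K kr a with
    | some A => some A.neg
    | none => none
  | exp a =>
    match encl S K kr a with
    | some A => MI.exp S K kr A
    | none => none

/-- **Soundness of the interval evaluator.** [folklore] -/
theorem mem_encl {S K kr : ℕ} (hS : 0 < S) : ∀ (e : RExpr) {Y : MI}, encl S K kr e = some Y → MI.mem S (val e) Y
  | frac p q, Y, h => by
    simp only [encl] at h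
    split_ifs at h with hq
    simp only [Option.some.injEq] at h
    subst h
    exact MI.mem_ofFrac S p (Nat.pos_of_ne_zero hq)
  | logNat n, Y, h => by
    simp only [encl] at h
    exact MI.mem_logNat hS h
  | logOneSubInv n, Y, h => by
    simp only [encl] at h
    split_ifs at h with hn
    have hmem : MI.mem S (1 / (n : ℝ)) (MI.ofFrac S 1 n) := by
      have := MI.mem_ofFrac S 1 (Nat.pos_of_ne_zero hn)
      simpa using this
    exact MI.mem_logOneSub hS h hmem
  | add a b, Y, h => by
    simp only [encl] at h
    split at h
    · rename_i A B hA hB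
      simp only [Option.some.injEq] at h
      subst h
      exact MI.mem_add (mem_encl hS a hA) (mem_encl hS b hB)
    · simp at h
  | sub a b, Y, h => by
    simp only [encl] at h
    split at h
    · rename_i A B hA hB
      simp only [Option.some.injEq] at h
      subst h
      exact MI.mem_sub (mem_encl hS a hA) (mem_encl hS b hB)
    · simp at h
  | mul a b, Y, h => by
    simp only [encl] at h
    split at h
    · rename_i A B hA hB
      simp only [Option.some.injEq] at h
      subst h
      exact MI.mem_mul hS (mem_encl hS a hA) (mem_encl hS b hB)
    · simp at h
  | div a b, Y, h => by
    simp only [encl] at h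
    split at h
    · rename_i A B hA hB
      exact MI.mem_divPos hS h (mem_encl hS a hA) (mem_encl hS b hB)
    · simp at h
  | neg a, Y, h => by
    simp only [encl] at h
    split at h
    · rename_i A hA
      simp only [Option.some.injEq] at h
      subst h
      exact MI.mem_neg (mem_encl hS a hA)
    · simp at h
  | exp a, Y, h => by
    simp only [encl] at h
    split at h
    · rename_i A hA
      exact MI.mem_exp hS h (mem_encl hS a hA)
    · simp at h

/-- `val e ≤ p/q` from the enclosure: `Y.hi · q ≤ p · S`. [folklore] -/
theorem val_le_of_hi {S K kr : ℕ} (hS : 0 < S) {e : RExpr} {Y : MI} (h : encl S K kr e = some Y)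
    {p : ℤ} {q : ℕ} (hq : 0 < q) (hle : Y.hi * q ≤ p * S) : val e ≤ (p : ℝ) / q := by
  have hm := mem_encl hS e h
  have hSr : (0 : ℝ) < S := by exact_mod_cast hS
  have hqr : (0 : ℝ) < q := by exact_mod_cast hq
  have h1 : val e * S ≤ Y.hi := hm.2
  have h2 : (Y.hi : ℝ) * q ≤ p * S := by exact_mod_cast hle
  rw [le_div_iff₀ hqr]
  nlinarith

/-- `p/q ≤ val e` from the enclosure: `p · S ≤ Y.lo · q`. [folklore] -/
theorem le_val_of_lo {S K kr : ℕ} (hS : 0 < S) {e : RExpr} {Y : MI} (h : encl S K kr e = some Y)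
    {p : ℤ} {q : ℕ} (hq : 0 < q) (hle : p * S ≤ Y.lo * q) : (p : ℝ) / q ≤ val e := by
  have hm := mem_encl hS e h
  have hSr : (0 : ℝ) < S := by exact_mod_cast hS
  have hqr : (0 : ℝ) < q := by exact_mod_cast hq
  have h1 : (Y.lo : ℝ) ≤ val e * S := hm.1
  have h2 : (p : ℝ) * S ≤ Y.lo * q := by exact_mod_cast hle
  rw [div_le_iff₀ hqr]
  nlinarith

/-- `val e₁ ≤ val e₂` from `Y₁.hi ≤ Y₂.lo`. [folklore] -/
theorem val_le_val {S K kr : ℕ} (hS : 0 < S) {e₁ e₂ : RExpr} {Y₁ Y₂ : MI}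
    (h₁ : encl S K kr e₁ = some Y₁) (h₂ : encl S K kr e₂ = some Y₂) (hle : Y₁.hi ≤ Y₂.lo) :
    val e₁ ≤ val e₂ := by
  have hm₁ := mem_encl hS e₁ h₁
  have hm₂ := mem_encl hS e₂ h₂
  have hSr : (0 : ℝ) < S := by exact_mod_cast hS
  have : (Y₁.hi : ℝ) ≤ Y₂.lo := by exact_mod_cast hle
  nlinarith [hm₁.2, hm₂.1]

/-- `val e < p/q` from `Y.hi · q < p · S`. [folklore] -/
theorem val_lt_of_hi {S K kr : ℕ} (hS : 0 < S) {e : RExpr} {Y : MI} (h : encl S K kr e = some Y)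
    {p : ℤ} {q : ℕ} (hq : 0 < q) (hlt : Y.hi * q < p * S) : val e < (p : ℝ) / q := by
  have hm := mem_encl hS e h
  have hSr : (0 : ℝ) < S := by exact_mod_cast hS
  have hqr : (0 : ℝ) < q := by exact_mod_cast hq
  have h1 : val e * S ≤ Y.hi := hm.2
  have h2 : (Y.hi : ℝ) * q < p * S := by exact_mod_cast hlt
  rw [lt_div_iff₀ hqr]
  nlinarith

end RExpr

/-! ### Parameter rows and the row checker -/

/-- One certified parameter row of the §5 scheme: the `λ`-interval `[lamloN/lamD, lamhiN/lamD]`,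
the integers `k, h, g, s, m₁, m₂, w⁺` and `η = etaN/etaD`. [cite: Ford2002, proofs of Lemmas 5.2–5.3] -/
structure Sec5Row where
  lamloN : ℕ
  lamhiN : ℕ
  lamD : ℕ
  k : ℕ
  h : ℕ
  g : ℕ
  s : ℕ
  m₁ : ℕ
  m₂ : ℕ
  wp : ℕ
  etaN : ℕ
  etaD : ℕ
  deriving Repr, DecidableEq

namespace Sec5Row

/-- The numerator of `ρ` (denominator `100000`) of the row of (1.7) used for `k`. [cite: Ford2002, (1.7)] -/
def rhoN (k : ℕ) : ℕ := if 200 ≤ k then 321432 else if 150 ≤ k then 321734 else 322313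

/-- The numerator of `θ` (denominator `10000`) of the row of (1.7) used for `k`. [cite: Ford2002, (1.7)] -/
def thetaN (k : ℕ) : ℕ := if 200 ≤ k then 23291 else if 150 ≤ k then 23849 else 24183

variable (R : Sec5Row)

/-- `⌊ρ k²⌋`. [cite: Ford2002, (5.13)] -/
def rf : ℕ := rhoN R.k * R.k ^ 2 / 100000

/-- `r = ⌊ρ k²⌋ + 1`. [cite: Ford2002, (5.13)] -/
def r : ℕ := R.rf + 1

/-- `τ = g − h + 1` (the `t` of Theorem 4). [cite: Ford2002, §5] -/
def tau : ℕ := R.g - R.h + 1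

open RExpr

/-- Shorthand: a natural number as an expression. [folklore] -/
def nat (n : ℕ) : RExpr := frac (n : ℤ) 1

/-- `4 log g/(30.57 g² η)` of (1.10). [cite: Ford2002, (1.10)] -/
def e4 : RExpr := mul (frac ((400 * R.etaD : ℕ) : ℤ) (3057 * R.g ^ 2 * R.etaN)) (logNat R.g)

/-- The constant `C` of Theorem 4 at `(g, h, s, η, D = 30.57)` ((5.18)). [cite: Ford2002, (5.18)] -/
def eCT4 : RExpr :=
  add (add (frac ((R.s ^ 2 : ℕ) : ℤ) R.tau)
      (mul (frac ((1050 * R.tau * R.etaD ^ 2 : ℕ) : ℤ) (3057 * R.g * R.etaN ^ 2))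
        (mul (logNat R.g) (logNat R.g))))
    (neg (mul (mul (nat R.s)
      (sub (mul (add (frac (R.etaD : ℤ) R.etaN) (nat R.h))
              (exp (mul (frac (R.s : ℤ) R.tau) (logOneSubInv R.h))))
           (nat R.h)))
      (sub (logNat R.etaD) (logNat (10 * R.etaN)))))

/-- The left side of the constant condition `c8` of `FordVK.sec5_interval`. [cite: Ford2002, (5.22), (5.30)] -/
def e8 : RExpr :=
  add (mul (frac 1 R.r)
        (add (sub (add (mul (nat R.wp) (sub (logNat 208) (logNat 7)))
                       (mul (nat (R.wp + 2)) (logNat (R.wp + 2))))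
                  (nat (R.wp + 1)))
             (sub (logNat (R.etaN * 1603)) (logNat (R.etaD * 10000)))))
      (mul (frac 1 (2 * R.r * R.s))
        (add (add (add (mul (frac ((thetaN R.k * R.k ^ 3 : ℕ) : ℤ) 10000) (logNat R.k)) R.eCT4)
                  (mul (nat R.k) (logNat (5 * R.r))))
             (mul (nat R.tau) (add (add (add (logNat 16) (logNat R.g)) (mul (nat R.g) (logNat 4)))
                                   (logNat R.s)))))

/-- `log (9.463 − 0.002)`. [cite: Ford2002, Theorem 2] -/
def eCt : RExpr := sub (logNat 9461) (logNat 1000)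

/-- `E₂ = τ(τ−1)/2 + ηs²/(2τ) + hτ e^{−s/(hτ)}` of (5.18). [cite: Ford2002, (5.18)] -/
def eE2 : RExpr :=
  add (add (frac ((R.tau * (R.tau - 1) : ℕ) : ℤ) 2)
           (frac ((R.etaN * R.s ^ 2 : ℕ) : ℤ) (2 * R.tau * R.etaD)))
      (mul (nat (R.h * R.tau)) (exp (neg (frac (R.s : ℤ) (R.h * R.tau)))))

/-- `Z₀` of the closed form `∑ℓ_j = Z₀ + Z₁λ` (twice the bracket, divided by `2`). [cite: Ford2002, (5.12)] -/
def eZ0 : RExpr :=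
  add (add (frac (((R.m₂ : ℤ) - R.h + 1) * ((R.h : ℤ) + R.m₂)) 2)
           (frac (1603 * (((R.m₁ : ℤ) - R.m₂) * ((R.m₂ : ℤ) + 1 + R.m₁))) 20000))
      (neg (frac (6492 * (((R.g : ℤ) - R.m₁) * ((R.m₁ : ℤ) + 1 + R.g))) 20000))

/-- `Z₁`. [cite: Ford2002, (5.12)] -/
def Z1 : ℤ := ((R.g : ℤ) - R.m₁) - ((R.m₂ : ℤ) + 1 - R.h)

/-- The left side of the exponent condition `c9` of `FordVK.sec5_interval` at `λ* = lN/lamD`.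
[cite: Ford2002, (5.22), (5.31)] -/
def e9 (lN : ℕ) : RExpr :=
  add (add (mul (sub (logNat (300 * R.lamloN ^ 2)) (logNat (R.lamD ^ 2)))
                (frac ((R.lamD ^ 2 : ℕ) : ℤ) (300 * R.lamloN ^ 2 * R.r)))
           (mul (sub (add (frac ((1905 * R.k ^ 2 : ℕ) : ℤ) 10000000) (mul (frac 1603 10000) R.eE2))
                     (add R.eZ0 (frac (R.Z1 * lN) R.lamD)))
                (frac 1 (2 * R.r * R.s))))
      (frac ((100 * R.lamD ^ 2 : ℕ) : ℤ) (13366 * R.lamloN ^ 2))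

/-- Scale, series terms and exponential range reduction of the checker. [folklore] -/
def S5 : ℕ := 2 ^ 64
/-- Series terms. [folklore] -/
def K5 : ℕ := 48
/-- Range reduction of `exp`. [folklore] -/
def kr5 : ℕ := 4

/-- **The row checker**: the rational side conditions `c0`–`c7` of `FordVK.sec5_interval` and the
interval verifications of (1.10) (`c4c`, `c4d`), of the constant (`c8`, target `9.463`) and of the
exponent at both endpoints (`c9`). [cite: Ford2002, proofs of Lemmas 5.2–5.3 (Program 2)] -/
def check : Bool :=
  let lamloN := R.lamloN; let lamhiN := R.lamhiN; let lamD := R.lamD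
  let k := R.k; let h := R.h; let g := R.g; let s := R.s; let m₁ := R.m₁; let m₂ := R.m₂
  let wp := R.wp; let etaN := R.etaN; let etaD := R.etaD
  -- c0, c0', positivity, k ≥ 129 (row of (1.7))
  decide (0 < lamD ∧ 0 < etaN ∧ 0 < etaD ∧ 87 * lamD ≤ lamloN ∧ lamloN ≤ lamhiN ∧ 129 ≤ k) &&
  -- c1: `10⁷ lamhiN − 6492000 k lamD + 3508000 lamD ≤ (10⁷ − 19) lamD`
  decide ((10000000 * lamhiN + 3508000 * lamD : ℕ) ≤ 9999981 * lamD + 6492000 * k * lamD) &&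
  -- c2a–c2e
  decide (60 ≤ g ∧ 9 * g ≤ 10 * h ∧ h + 2 ≤ g ∧ 2 * (g - h + 1) ≤ s ∧ s ≤ (h / 2) * (g - h + 1)) &&
  -- c3: `3057 g² lamD² ≤ 4809 lamloN²`
  decide (3057 * g ^ 2 * lamD ^ 2 ≤ 4809 * lamloN ^ 2) &&
  -- c4a, c4b
  decide (2 * etaD < etaN * g ^ 3 ∧ 2 * g * etaN ≤ etaD) &&
  -- c5a–c5c
  decide (8000 * etaD * lamD ^ 2 ≤ 4809 * etaN * lamloN ^ 2 ∧ 2 * etaN ≤ etaD ∧ 26 * etaD ≤ 25 * wp * etaN) &&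
  -- c6
  decide (h ≤ m₂ + 1 ∧ m₂ ≤ m₁ ∧ m₁ ≤ g ∧ m₂ * 8397 * lamD ≤ 10000 * lamloN
    ∧ 10000 * lamhiN ≤ (m₂ + 1) * 8397 * lamD ∧ m₁ * 8095 * lamD ≤ 10000 * lamloN
    ∧ 10000 * lamhiN ≤ (m₁ + 1) * 8095 * lamD) &&
  -- c7
  decide (s ≤ R.rf + 1 ∧ 1 ≤ h ∧ g ≤ k) &&
  -- c4c, c4d: `18/g ≤ e4 ≤ 2/5`
  (match encl S5 K5 kr5 R.e4 with
   | some Y => decide ((18 : ℤ) * S5 ≤ Y.lo * g ∧ Y.hi * 5 ≤ 2 * S5)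
   | none => false) &&
  -- c8: `e8 ≤ eCt`
  (match encl S5 K5 kr5 R.e8, encl S5 K5 kr5 eCt with
   | some Y, some Z => decide (Y.hi ≤ Z.lo)
   | _, _ => false) &&
  -- c9 at both endpoints: `e9 ≤ 0`
  (match encl S5 K5 kr5 (R.e9 lamloN), encl S5 K5 kr5 (R.e9 lamhiN) with
   | some Y, some Z => decide (Y.hi * 1 ≤ 0 * S5 ∧ Z.hi * 1 ≤ 0 * S5)
   | _, _ => false)

end Sec5Row

/-! ### Soundness of the row checker -/

namespace Sec5Row

open RExpr

variable (R : Sec5Row)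

/-- `S5 > 0`. [folklore] -/
theorem S5_pos : 0 < S5 := by unfold S5; positivity

/-- Casting `τ`. [folklore] -/
theorem tau_cast (hhg : R.h ≤ R.g) : (R.tau : ℝ) = (R.g : ℝ) - R.h + 1 := by
  unfold tau; rw [Nat.cast_add, Nat.cast_sub hhg]; push_cast; ring

/-- Casting `τ − 1`. [folklore] -/
theorem tau_sub_one_cast (hhg : R.h ≤ R.g) : ((R.tau - 1 : ℕ) : ℝ) = (R.g : ℝ) - R.h := by
  unfold tau; rw [Nat.add_sub_cancel, Nat.cast_sub hhg]

/-- `⌊ρ k²⌋ = rf` for `ρ = rhoN/100000`. [folklore] -/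
theorem floor_rho_eq : ⌊((rhoN R.k : ℕ) : ℝ) / 100000 * (R.k : ℝ) ^ 2⌋₊ = R.rf := by
  unfold rf
  rw [show ((rhoN R.k : ℕ) : ℝ) / 100000 * (R.k : ℝ) ^ 2 = ((rhoN R.k * R.k ^ 2 : ℕ) : ℝ) / (100000 : ℕ) by
    push_cast; ring]
  exact Nat.floor_div_eq_div _ _

/-- The value of `e4`. [folklore] -/
theorem val_e4 (hg : 0 < R.g) (hN : 0 < R.etaN) (hD : 0 < R.etaD) :
    val R.e4 = 4 * Real.log R.g / (30.57 * (R.g : ℝ) ^ 2 * ((R.etaN : ℝ) / R.etaD)) := by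
  have hg' : (0 : ℝ) < R.g := by exact_mod_cast hg
  have hN' : (0 : ℝ) < R.etaN := by exact_mod_cast hN
  have hD' : (0 : ℝ) < R.etaD := by exact_mod_cast hD
  simp only [e4, RExpr.val]
  push_cast
  field_simp
  ring

/-- The value of `eCT4`. [folklore] -/
theorem val_eCT4 (hhg : R.h ≤ R.g) (hh2 : 2 ≤ R.h) (hN : 0 < R.etaN) (hD : 0 < R.etaD) (hg : 0 < R.g) :
    val R.eCT4 = (R.s : ℝ) ^ 2 / ((R.g : ℝ) - R.h + 1)
      + 10.5 * ((R.g : ℝ) - R.h + 1) * Real.log R.g ^ 2 / (30.57 * R.g * ((R.etaN : ℝ) / R.etaD) ^ 2)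
      - R.s * ((1 / ((R.etaN : ℝ) / R.etaD) + R.h)
          * (1 - 1 / (R.h : ℝ)) ^ ((R.s : ℝ) / ((R.g : ℝ) - R.h + 1)) - R.h)
        * Real.log (1 / (10 * ((R.etaN : ℝ) / R.etaD))) := by
  have hN' : (0 : ℝ) < R.etaN := by exact_mod_cast hN
  have hD' : (0 : ℝ) < R.etaD := by exact_mod_cast hD
  have hg' : (0 : ℝ) < R.g := by exact_mod_cast hg
  have hh' : (2 : ℝ) ≤ R.h := by exact_mod_cast hh2
  have hpos : (0 : ℝ) < 1 - 1 / (R.h : ℝ) := by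
    rw [sub_pos, div_lt_one (by linarith)]; linarith
  have hrpow : (1 - 1 / (R.h : ℝ)) ^ ((R.s : ℝ) / ((R.g : ℝ) - R.h + 1))
      = Real.exp ((R.s : ℝ) / ((R.g : ℝ) - R.h + 1) * Real.log (1 - 1 / (R.h : ℝ))) := by
    rw [Real.rpow_def_of_pos hpos]; ring_nf
  have hlog10 : Real.log (1 / (10 * ((R.etaN : ℝ) / R.etaD))) = Real.log R.etaD - Real.log (10 * (R.etaN : ℝ)) := by
    rw [← Real.log_div hD'.ne' (by positivity)]
    congr 1; field_simp
  simp only [eCT4, RExpr.val, Sec5Row.nat]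
  push_cast
  rw [R.tau_cast hhg, hrpow, hlog10]
  generalize Real.exp ((R.s : ℝ) / ((R.g : ℝ) - R.h + 1) * Real.log (1 - 1 / (R.h : ℝ))) = E
  generalize Real.log (R.g : ℝ) = Lg
  generalize Real.log (R.etaD : ℝ) = LD
  generalize Real.log (10 * (R.etaN : ℝ)) = LN10
  have hτ0 : (R.g : ℝ) - R.h + 1 ≠ 0 := by
    have : (R.h : ℝ) ≤ R.g := by exact_mod_cast hhg
    linarith
  field_simp
  ring

/-- The value of `eE2`. [folklore] -/
theorem val_eE2 (hhg : R.h ≤ R.g) (hD : 0 < R.etaD) :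
    val R.eE2 = ((R.g : ℝ) - R.h + 1) * ((R.g : ℝ) - R.h) / 2
      + ((R.etaN : ℝ) / R.etaD) * (R.s : ℝ) ^ 2 / (2 * ((R.g : ℝ) - R.h + 1))
      + R.h * ((R.g : ℝ) - R.h + 1) * Real.exp (-(R.s : ℝ) / (R.h * ((R.g : ℝ) - R.h + 1))) := by
  have hD' : (0 : ℝ) < R.etaD := by exact_mod_cast hD
  have hτ0 : (0 : ℝ) < (R.g : ℝ) - R.h + 1 := by
    have : (R.h : ℝ) ≤ R.g := by exact_mod_cast hhg
    linarith
  simp only [eE2, RExpr.val, Sec5Row.nat]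
  push_cast
  rw [R.tau_sub_one_cast hhg, R.tau_cast hhg]
  have e1 : -((R.s : ℝ) / ((R.h : ℝ) * ((R.g : ℝ) - R.h + 1))) = -(R.s : ℝ) / ((R.h : ℝ) * ((R.g : ℝ) - R.h + 1)) := by
    ring
  rw [e1]
  generalize Real.exp (-(R.s : ℝ) / ((R.h : ℝ) * ((R.g : ℝ) - R.h + 1))) = E
  field_simp

/-- The value of `eZ0`. [folklore] -/
theorem val_eZ0 :
    val R.eZ0 = ((R.m₂ : ℝ) - R.h + 1) * (R.h + R.m₂) / 2
      + 0.1603 * (((R.m₁ : ℝ) - R.m₂) * ((R.m₂ : ℝ) + 1 + R.m₁) / 2)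
      - (1 - 0.1905 - 0.1603) * (((R.g : ℝ) - R.m₁) * ((R.m₁ : ℝ) + 1 + R.g) / 2) := by
  simp only [eZ0, RExpr.val]
  push_cast
  ring

/-- The value of `e8`. [folklore] -/
theorem val_e8 (hhg : R.h ≤ R.g) (hh2 : 2 ≤ R.h) (hN : 0 < R.etaN) (hD : 0 < R.etaD) (hg : 0 < R.g)
    (hs : 0 < R.s) :
    val R.e8 = (1 / ((R.rf : ℕ) + 1 : ℝ))
        * (R.wp * Real.log (208 / 7) + ((R.wp : ℝ) + 2) * Real.log ((R.wp : ℝ) + 2) - ((R.wp : ℝ) + 1)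
          + Real.log (((R.etaN : ℝ) / R.etaD) * 0.1603))
        + (1 / (2 * (((R.rf : ℕ) : ℝ) + 1) * R.s))
          * (((thetaN R.k : ℕ) : ℝ) / 10000 * (R.k : ℝ) ^ 3 * Real.log R.k
            + ((R.s : ℝ) ^ 2 / ((R.g : ℝ) - R.h + 1)
              + 10.5 * ((R.g : ℝ) - R.h + 1) * Real.log R.g ^ 2 / (30.57 * R.g * ((R.etaN : ℝ) / R.etaD) ^ 2)
              - R.s * ((1 / ((R.etaN : ℝ) / R.etaD) + R.h)
                  * (1 - 1 / (R.h : ℝ)) ^ ((R.s : ℝ) / ((R.g : ℝ) - R.h + 1)) - R.h)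
                * Real.log (1 / (10 * ((R.etaN : ℝ) / R.etaD))))
            + R.k * Real.log (5 * ((((R.rf : ℕ) : ℝ) + 1)))
            + ((R.g : ℝ) - R.h + 1) * Real.log (16 * (R.g : ℝ) * 4 ^ R.g * R.s)) := by
  have hN' : (0 : ℝ) < R.etaN := by exact_mod_cast hN
  have hD' : (0 : ℝ) < R.etaD := by exact_mod_cast hD
  have hg' : (0 : ℝ) < R.g := by exact_mod_cast hg
  have hs' : (0 : ℝ) < R.s := by exact_mod_cast hs
  have hCT4 := R.val_eCT4 hhg hh2 hN hD hg
  -- rewrite the logarithms of products/quotients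
  have l1 : Real.log (208 / 7) = Real.log ((208 : ℕ) : ℝ) - Real.log ((7 : ℕ) : ℝ) := by
    rw [← Real.log_div (by norm_num) (by norm_num)]; norm_num
  have l2 : Real.log (((R.etaN : ℝ) / R.etaD) * 0.1603)
      = Real.log ((R.etaN * 1603 : ℕ) : ℝ) - Real.log ((R.etaD * 10000 : ℕ) : ℝ) := by
    rw [← Real.log_div (by positivity) (by positivity)]
    congr 1; push_cast; field_simp; norm_num
  have l3 : Real.log (5 * ((((R.rf : ℕ) : ℝ) + 1))) = Real.log ((5 * R.r : ℕ) : ℝ) := by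
    congr 1; unfold r; push_cast; ring
  have l4 : Real.log (16 * (R.g : ℝ) * 4 ^ R.g * R.s)
      = Real.log ((16 : ℕ) : ℝ) + Real.log R.g + R.g * Real.log ((4 : ℕ) : ℝ) + Real.log R.s := by
    rw [Real.log_mul (by positivity) hs'.ne', Real.log_mul (by positivity) (by positivity),
      Real.log_mul (by norm_num) hg'.ne', Real.log_pow]
    norm_num
  have l5 : Real.log ((R.wp : ℝ) + 2) = Real.log ((R.wp + 2 : ℕ) : ℝ) := by push_cast; ring_nf
  have hr : ((R.r : ℕ) : ℝ) = ((R.rf : ℕ) : ℝ) + 1 := by unfold r; push_cast; ring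
  rw [l1, l2, l3, l4, l5]
  simp only [e8, RExpr.val, Sec5Row.nat]
  rw [hCT4]
  push_cast
  rw [R.tau_cast hhg, hr]
  have hr0 : ((R.rf : ℕ) : ℝ) + 1 ≠ 0 := by positivity
  field_simp

/-- The value of `e9 lN`. [folklore] -/
theorem val_e9 (hhg : R.h ≤ R.g) (hD : 0 < R.etaD) (hlam : 0 < R.lamloN) (hlamD : 0 < R.lamD)
    (hs : 0 < R.s) (lN : ℕ) :
    val (R.e9 lN) = Real.log (300 * ((R.lamloN : ℝ) / R.lamD) ^ 2) / (300 * ((R.lamloN : ℝ) / R.lamD) ^ 2)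
          / ((((R.rf : ℕ) : ℝ) + 1))
        + (0.1905 * (0.001 * (R.k : ℝ) ^ 2)
            + 0.1603 * (((R.g : ℝ) - R.h + 1) * ((R.g : ℝ) - R.h) / 2
              + ((R.etaN : ℝ) / R.etaD) * (R.s : ℝ) ^ 2 / (2 * ((R.g : ℝ) - R.h + 1))
              + R.h * ((R.g : ℝ) - R.h + 1) * Real.exp (-(R.s : ℝ) / (R.h * ((R.g : ℝ) - R.h + 1))))
            - ((((R.m₂ : ℝ) - R.h + 1) * (R.h + R.m₂) / 2
                + 0.1603 * (((R.m₁ : ℝ) - R.m₂) * ((R.m₂ : ℝ) + 1 + R.m₁) / 2)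
                - (1 - 0.1905 - 0.1603) * (((R.g : ℝ) - R.m₁) * ((R.m₁ : ℝ) + 1 + R.g) / 2))
              + (((R.g : ℝ) - R.m₁) - ((R.m₂ : ℝ) + 1 - R.h)) * ((lN : ℝ) / R.lamD)))
          / (2 * ((((R.rf : ℕ) : ℝ) + 1)) * R.s)
        + 1 / (133.66 * ((R.lamloN : ℝ) / R.lamD) ^ 2) := by
  have hD' : (0 : ℝ) < R.etaD := by exact_mod_cast hD
  have hl' : (0 : ℝ) < R.lamloN := by exact_mod_cast hlam
  have hlD' : (0 : ℝ) < R.lamD := by exact_mod_cast hlamD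
  have hs' : (0 : ℝ) < R.s := by exact_mod_cast hs
  have hE2 := R.val_eE2 hhg hD
  have hZ0 := R.val_eZ0
  have l1 : Real.log (300 * ((R.lamloN : ℝ) / R.lamD) ^ 2)
      = Real.log ((300 * R.lamloN ^ 2 : ℕ) : ℝ) - Real.log ((R.lamD ^ 2 : ℕ) : ℝ) := by
    rw [← Real.log_div (by positivity) (by positivity)]
    congr 1; push_cast; field_simp
  have hr : ((R.r : ℕ) : ℝ) = ((R.rf : ℕ) : ℝ) + 1 := by unfold r; push_cast; ring
  rw [l1]
  simp only [e9, RExpr.val, Z1]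
  rw [hE2, hZ0]
  push_cast
  rw [hr]
  have hr0 : ((R.rf : ℕ) : ℝ) + 1 ≠ 0 := by positivity
  generalize Real.exp (-(R.s : ℝ) / ((R.h : ℝ) * ((R.g : ℝ) - R.h + 1))) = E
  generalize Real.log ((300 * R.lamloN ^ 2 : ℕ) : ℝ) = L1
  generalize Real.log ((R.lamD ^ 2 : ℕ) : ℝ) = L2
  field_simp
  ring

/-- **Soundness of the row checker**: `check R = true` gives Theorem 2 with constant `9.463` on the
`λ`-interval of the row in the nontrivial range, from the row of (1.7) at `k` (Theorem 3) and
Theorem 4. [cite: Ford2002, proofs of Lemmas 5.2–5.3] -/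
theorem sound (hc : R.check = true)
    (hT3a : ∀ k : ℕ, 200 ≤ k → ∃ s₃ : ℕ, 1 ≤ s₃ ∧ (s₃ : ℝ) ≤ 3.21432 * (k : ℝ) ^ 2 ∧ ∀ P : ℕ, 1 ≤ P →
      (VMV.J k s₃ (Finset.Icc (1 : ℤ) P) : ℝ) ≤ (k : ℝ) ^ (2.3291 * (k : ℝ) ^ 3)
        * (P : ℝ) ^ ((2 * s₃ : ℝ) - ((k * (k + 1) / 2 : ℕ) : ℝ) + 0.001 * (k : ℝ) ^ 2))
    (hT3b : ∀ k : ℕ, 150 ≤ k → k ≤ 199 → ∃ s₃ : ℕ, 1 ≤ s₃ ∧ (s₃ : ℝ) ≤ 3.21734 * (k : ℝ) ^ 2 ∧ ∀ P : ℕ, 1 ≤ P →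
      (VMV.J k s₃ (Finset.Icc (1 : ℤ) P) : ℝ) ≤ (k : ℝ) ^ (2.3849 * (k : ℝ) ^ 3)
        * (P : ℝ) ^ ((2 * s₃ : ℝ) - ((k * (k + 1) / 2 : ℕ) : ℝ) + 0.001 * (k : ℝ) ^ 2))
    (hT3c : ∀ k : ℕ, 129 ≤ k → k ≤ 149 → ∃ s₃ : ℕ, 1 ≤ s₃ ∧ (s₃ : ℝ) ≤ 3.22313 * (k : ℝ) ^ 2 ∧ ∀ P : ℕ, 1 ≤ P →
      (VMV.J k s₃ (Finset.Icc (1 : ℤ) P) : ℝ) ≤ (k : ℝ) ^ (2.4183 * (k : ℝ) ^ 3)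
        * (P : ℝ) ^ ((2 * s₃ : ℝ) - ((k * (k + 1) / 2 : ℕ) : ℝ) + 0.001 * (k : ℝ) ^ 2))
    (hT4 : ∀ (k h s : ℕ) (P η D : ℝ), 60 ≤ k → (0.9 : ℝ) * k ≤ h → h + 2 ≤ k →
      2 * (k - h + 1) ≤ s → s ≤ (h / 2) * (k - h + 1) → 10 ≤ D → Real.exp (D * (k : ℝ) ^ 2) ≤ P →
      2 / (k : ℝ) ^ 3 < η → η ≤ 1 / (2 * (k : ℝ)) →
      18 / (k : ℝ) ≤ 4 * Real.log k / (D * (k : ℝ) ^ 2 * η) →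
      4 * Real.log k / (D * (k : ℝ) ^ 2 * η) ≤ 0.4 →
      (Jinc k s ((calC P (P ^ η)).map Nat.castEmbedding) h k : ℝ)
        ≤ Real.exp ((s : ℝ) ^ 2 / ((k : ℝ) - h + 1)
            + 10.5 * ((k : ℝ) - h + 1) * Real.log k ^ 2 / (D * k * η ^ 2)
            - s * ((1 / η + h) * (1 - 1 / (h : ℝ)) ^ ((s : ℝ) / ((k : ℝ) - h + 1)) - h)
              * Real.log (1 / (10 * η)))
          * P ^ ((2 * s : ℝ) - ((k : ℝ) - h + 1) / 2 * (h + k) + ((k : ℝ) - h + 1) * ((k : ℝ) - h) / 2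
            + η * (s : ℝ) ^ 2 / (2 * ((k : ℝ) - h + 1))
            + h * ((k : ℝ) - h + 1) * Real.exp (-(s : ℝ) / (h * ((k : ℝ) - h + 1)))))
    {N R₀ : ℕ} {t u : ℝ} (hN : 2 ≤ N) (hNR : N < R₀) (hR : R₀ ≤ 2 * N) (hu0 : 0 < u) (hu1 : u ≤ 1)
    (ht0 : 0 < t) (hlo : (R.lamloN : ℝ) / R.lamD * Real.log N ≤ Real.log t)
    (hhi : Real.log t ≤ (R.lamhiN : ℝ) / R.lamD * Real.log N)
    (hbig : 300 * (Real.log t / Real.log N) ^ 2 ≤ Real.log N) :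
    ‖∑ n ∈ Ioc N R₀, ((n : ℂ) + u) ^ (-(t * Complex.I))‖
      ≤ 9.463 * (N : ℝ) ^ (1 - Real.log N ^ 2 / (133.66 * Real.log t ^ 2)) := by
  -- unpack the checker
  simp only [check, Bool.and_eq_true, decide_eq_true_eq] at hc
  obtain ⟨⟨⟨⟨⟨⟨⟨⟨⟨⟨⟨hlamD, hetaN, hetaD, h87, hlohi, hk129⟩, hc1⟩, ⟨hc2a, hc2b, hc2c, hc2d, hc2e⟩⟩, hc3⟩,
    ⟨hc4a, hc4b⟩⟩, ⟨hc5a, hc5b, hc5c⟩⟩, ⟨hc6a, hc6b, hc6c, hc6d, hc6e, hc6f, hc6g⟩⟩, ⟨hc7a, hc7b, hc7c⟩⟩,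
    h4cd⟩, h8⟩, h9⟩ := hc
  -- the row of (1.7) at `k`
  have hT3 : ∃ s₃ : ℕ, 1 ≤ s₃ ∧ (s₃ : ℝ) ≤ ((rhoN R.k : ℕ) : ℝ) / 100000 * (R.k : ℝ) ^ 2 ∧ ∀ P : ℕ, 1 ≤ P →
      (VMV.J R.k s₃ (Finset.Icc (1 : ℤ) P) : ℝ) ≤ (R.k : ℝ) ^ (((thetaN R.k : ℕ) : ℝ) / 10000 * (R.k : ℝ) ^ 3)
        * (P : ℝ) ^ ((2 * s₃ : ℝ) - ((R.k * (R.k + 1) / 2 : ℕ) : ℝ) + 0.001 * (R.k : ℝ) ^ 2) := by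
    unfold rhoN thetaN
    split_ifs with h200 h150
    · obtain ⟨s₃, h1, h2, h3⟩ := hT3a R.k h200
      refine ⟨s₃, h1, by norm_num; linarith [h2], fun P hP => ?_⟩
      have := h3 P hP; norm_num at this ⊢; exact this
    · obtain ⟨s₃, h1, h2, h3⟩ := hT3b R.k h150 (by omega)
      refine ⟨s₃, h1, by norm_num; linarith [h2], fun P hP => ?_⟩
      have := h3 P hP; norm_num at this ⊢; exact this
    · obtain ⟨s₃, h1, h2, h3⟩ := hT3c R.k hk129 (by omega)
      refine ⟨s₃, h1, by norm_num; linarith [h2], fun P hP => ?_⟩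
      have := h3 P hP; norm_num at this ⊢; exact this
  -- casts of the data
  have hlamD' : (0 : ℝ) < R.lamD := by exact_mod_cast hlamD
  have hetaN' : (0 : ℝ) < R.etaN := by exact_mod_cast hetaN
  have hetaD' : (0 : ℝ) < R.etaD := by exact_mod_cast hetaD
  have hhg : R.h ≤ R.g := by omega
  have hg0 : 0 < R.g := by omega
  have hh2 : 2 ≤ R.h := by omega
  have hs0 : 0 < R.s := by omega
  have hlamlo0 : 0 < R.lamloN := by
    have : 0 < 87 * R.lamD := by omega
    omega
  set lamlo : ℝ := (R.lamloN : ℝ) / R.lamD with hlamlo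
  set lamhi : ℝ := (R.lamhiN : ℝ) / R.lamD with hlamhi
  set η : ℝ := (R.etaN : ℝ) / R.etaD with hη
  have hηpos : 0 < η := by positivity
  -- the interval conditions
  have hS := S5_pos
  -- c4c, c4d
  have hc4 : 18 / (R.g : ℝ) ≤ 4 * Real.log R.g / (30.57 * (R.g : ℝ) ^ 2 * η)
      ∧ 4 * Real.log R.g / (30.57 * (R.g : ℝ) ^ 2 * η) ≤ 0.4 := by
    split at h4cd
    · rename_i Y hY
      simp only [decide_eq_true_eq] at h4cd
      rw [← R.val_e4 hg0 hetaN hetaD]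
      constructor
      · have := le_val_of_lo hS hY (p := 18) (q := R.g) hg0 (by exact_mod_cast h4cd.1)
        simpa using this
      · have := val_le_of_hi hS hY (p := 2) (q := 5) (by norm_num) (by exact_mod_cast h4cd.2)
        norm_num at this
        linarith
    · exact absurd h4cd (by simp)
  -- c8
  have hc8 : val R.e8 ≤ Real.log (9.463 - 0.002) := by
    split at h8
    · rename_i Y Z hY hZ
      simp only [decide_eq_true_eq] at h8
      have := val_le_val hS hY hZ h8
      refine this.trans (le_of_eq ?_)
      simp only [eCt, RExpr.val]
      rw [← Real.log_div (by norm_num) (by norm_num)]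
      norm_num
    · exact absurd h8 (by simp)
  -- c9
  have hc9 : val (R.e9 R.lamloN) ≤ 0 ∧ val (R.e9 R.lamhiN) ≤ 0 := by
    split at h9
    · rename_i Y Z hY hZ
      simp only [decide_eq_true_eq] at h9
      constructor
      · have := val_le_of_hi hS hY (p := 0) (q := 1) (by norm_num) h9.1
        simpa using this
      · have := val_le_of_hi hS hZ (p := 0) (q := 1) (by norm_num) h9.2
        simpa using this
    · exact absurd h9 (by simp)
  rw [R.val_e8 hhg hh2 hetaN hetaD hg0 hs0] at hc8
  rw [R.val_e9 hhg hetaD hlamlo0 hlamD hs0, R.val_e9 hhg hetaD hlamlo0 hlamD hs0] at hc9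
  -- apply the interval theorem
  refine sec5_interval (k := R.k) (h := R.h) (g := R.g) (s := R.s) (m₁ := R.m₁) (m₂ := R.m₂) (wp := R.wp)
    (lamlo := lamlo) (lamhi := lamhi) (η := η) (ρ := ((rhoN R.k : ℕ) : ℝ) / 100000)
    (θ := ((thetaN R.k : ℕ) : ℝ) / 10000) (Ctar := 9.463) hT3 hT4
    ?_ ?_ hηpos (by norm_num) ?_ hc2a ?_ hc2c hc2d hc2e ?_ ?_ ?_ hc4.1 hc4.2 ?_ ?_ ?_ hc6a hc6b hc6c ?_ ?_ ?_ ?_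
    ?_ hc7b hc7c ?_ ?_ hN hNR hR hu0 hu1 ht0 hlo hhi hbig
  · -- c0
    rw [hlamlo, le_div_iff₀ hlamD']; exact_mod_cast h87
  · -- c0'
    rw [hlamlo, hlamhi]; exact div_le_div_of_nonneg_right (by exact_mod_cast hlohi) hlamD'.le
  · -- c1
    have : (10000000 * (R.lamhiN : ℝ) + 3508000 * R.lamD) ≤ 9999981 * R.lamD + 6492000 * R.k * R.lamD := by
      exact_mod_cast hc1
    rw [hlamhi]
    rw [div_sub' (hc := hlamD'.ne'), div_add' _ _ _ hlamD'.ne', div_le_iff₀ hlamD']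
    nlinarith only [this, hlamD']
  · -- c2b
    have : (9 : ℝ) * R.g ≤ 10 * R.h := by exact_mod_cast hc2b
    linarith
  · -- c3
    have : (3057 : ℝ) * R.g ^ 2 * R.lamD ^ 2 ≤ 4809 * R.lamloN ^ 2 := by exact_mod_cast hc3
    rw [hlamlo, div_pow]
    rw [show (0.1603 : ℝ) * 300 * ((R.lamloN : ℝ) ^ 2 / (R.lamD : ℝ) ^ 2)
      = 48.09 * (R.lamloN : ℝ) ^ 2 / (R.lamD : ℝ) ^ 2 by ring, le_div_iff₀ (by positivity)]
    nlinarith only [this]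
  · -- c4a
    have : (2 : ℝ) * R.etaD < R.etaN * R.g ^ 3 := by exact_mod_cast hc4a
    rw [hη, div_lt_div_iff₀ (by positivity) hetaD']
    nlinarith only [this]
  · -- c4b
    have : (2 : ℝ) * R.g * R.etaN ≤ R.etaD := by exact_mod_cast hc4b
    rw [hη, div_le_div_iff₀ hetaD' (by positivity)]
    nlinarith only [this]
  · -- c5a
    have : (8000 : ℝ) * R.etaD * R.lamD ^ 2 ≤ 4809 * R.etaN * R.lamloN ^ 2 := by exact_mod_cast hc5a
    rw [hη, hlamlo, div_pow]
    rw [show (R.etaN : ℝ) / R.etaD * (0.1603 * 300 * ((R.lamloN : ℝ) ^ 2 / (R.lamD : ℝ) ^ 2))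
      = 48.09 * R.etaN * (R.lamloN : ℝ) ^ 2 / (R.etaD * (R.lamD : ℝ) ^ 2) by field_simp; ring,
      le_div_iff₀ (by positivity)]
    nlinarith only [this]
  · -- c5b
    have : (2 : ℝ) * R.etaN ≤ R.etaD := by exact_mod_cast hc5b
    rw [hη, one_div_div, le_div_iff₀ hetaN']
    linarith
  · -- c5c
    have : (26 : ℝ) * R.etaD ≤ 25 * R.wp * R.etaN := by exact_mod_cast hc5c
    rw [hη, one_div_div, show 26 * ((R.etaD : ℝ) / R.etaN) / 25 = 26 * R.etaD / (25 * R.etaN) by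
      field_simp, div_le_iff₀ (by positivity)]
    nlinarith only [this]
  · -- c6d
    have : (R.m₂ : ℝ) * 8397 * R.lamD ≤ 10000 * R.lamloN := by exact_mod_cast hc6d
    rw [hlamlo, le_div_iff₀ hlamD']
    nlinarith only [this]
  · -- c6e
    have : (10000 : ℝ) * R.lamhiN ≤ (R.m₂ + 1) * 8397 * R.lamD := by exact_mod_cast hc6e
    rw [hlamhi, div_le_iff₀ hlamD']
    nlinarith only [this]
  · -- c6f
    have : (R.m₁ : ℝ) * 8095 * R.lamD ≤ 10000 * R.lamloN := by exact_mod_cast hc6f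
    rw [hlamlo, le_div_iff₀ hlamD']
    nlinarith only [this]
  · -- c6g
    have : (10000 : ℝ) * R.lamhiN ≤ (R.m₁ + 1) * 8095 * R.lamD := by exact_mod_cast hc6g
    rw [hlamhi, div_le_iff₀ hlamD']
    nlinarith only [this]
  · -- c7a
    rw [R.floor_rho_eq]; exact hc7a
  · -- c8
    rw [R.floor_rho_eq]; exact hc8
  · -- c9
    rw [R.floor_rho_eq]
    intro lstar hl
    rcases hl with rfl | rfl
    · exact hc9.1
    · exact hc9.2

end Sec5Row



end FordVK
end Literature.NumberTheory.LFunctions
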